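import Literature.Combinatorics.AssociationSchemes.JohnsonHarmonics
import Summits.PneNP.PneNP.Theorems.ChebyshevTracialDesignPairTransitive
import HarnessLib

/-!
# Cell pnp-psdrank, route `ChebyshevTracialDesign`: Johnson class kernels act as scalars on the
# harmonic layers (the zonal identity), with the eigenvalue read off any test vector

Harmonic backbone, brick 1 (prover R1-SKELETON S3 "NEXT"; planner p1 N2-SpreadStructure.md §SNT (2), Step 3).
For a harmonic coefficient vector `p` of degree `k` (lit's ladder calculus
`Literature.Combinatorics.AssociationSchemes.JohnsonHarmonics`: `p` supported on `k`-sets, `down p = 0`) and ANY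
vertex set `U`, the ZONAL SUMS `Z_i(U) = Σ_{|T ∩ U| = i} p_T` satisfy the two-term recurrence
`(i+1)·Z_{i+1}(U) + (k−i)·Z_i(U) = 0` (`harmonic_zonal_step`: sum the harmonicity relation `Σ_{x ∉ T'} p_{T' ∪ x} = 0`
over the `T'` with `|T' ∩ U| = i` and re-index by `T = T' ∪ x`), hence
`Z_i(U) = (−1)^{k−i} C(k,i) · zeta p (U)` (`harmonic_zonal_eq_zeta`; `Z_k(U) = Σ_{T ⊆ U} p_T = zeta p (U)`).
Consequently every CLASS-FUNCTION KERNEL `K(U,U') = g(|U ∩ U'|)` on the `t`-slice maps the layer-`k` function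
`U ↦ zeta p (U)` to a multiple of itself, with a factor depending only on `(n, t, k, g)`
(`exists_classKernel_scalar`: `Σ_{|U'| = t} g(|U ∩ U'|) zeta p (U') = λ · zeta p (U)`), and the factor is read off
any single test pair `(p₀, U₀)` with `zeta p₀ (U₀) ≠ 0` (`classKernel_scalar_eq_of_test`). This is Delsarte's
statement that the Bose–Mesner algebra of `J(n,t)` acts by scalars (Eberlein polynomials) on the harmonic layers
[cite: GodsilMeagher2015, §6.2–6.3 (eigenvalues of the Johnson scheme)], obtained here WITHOUT representation theory
or an explicit basis, from the ladder calculus plus `𝔖ₙ`-transitivity on pairs `(U, T)` of given sizes and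
intersection (`exists_perm_image_eq_pair`, p430440). Consumers: the `σ₂` brick (second eigenvalue of the tight kernel
`#{M : cc(U,M) = cc(U',M) = 1}`, a class function by `card_jointTight_eq`) and every spectral step of the r = 1 rung.
[cite: Rothvoss2017, §2 (PDF p. 6)] WHAT THIS IS NOT: no eigenvalue of a specific kernel is computed here; nothing on
psd rank. Supports crux stmt-PneNP-19878.
-/

set_option linter.dupNamespace false -- `Summit.PneNP.PneNP.…`: summit = sub-problem (D-0017)

noncomputable section

namespace Summit.PneNP.PneNP.Theorems.ChebyshevTracialDesignHarmonicLayers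

open Finset Literature.Combinatorics.AssociationSchemes Literature.Combinatorics.AssociationSchemes.JohnsonHarmonics
open Summit.PneNP.PneNP.Theorems.ChebyshevTracialDesignPairTransitive

variable {n : ℕ}

/-! ### §1 The zonal identity for harmonic vectors -/

/-- Removing a point of `T` inside `U` lowers `|T ∩ U|` by one; removing a point outside `U` keeps it:
the number of `x ∈ T` with `|(T \ {x}) ∩ U| = i` is `(i+1)·[|T ∩ U| = i+1] + |T \ U|·[|T ∩ U| = i]`. -/
theorem card_filter_erase_inter_eq (T U : Finset (Fin n)) (i : ℕ) :
    ((T.filter fun x => ((T.erase x) ∩ U).card = i).card : ℝ) =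
      (if (T ∩ U).card = i + 1 then ((i : ℝ) + 1) else 0) +
        (if (T ∩ U).card = i then ((T \ U).card : ℝ) else 0) := by
  classical
  have hsplit : T.filter (fun x => ((T.erase x) ∩ U).card = i) =
      (T ∩ U).filter (fun x => ((T.erase x) ∩ U).card = i) ∪
        (T \ U).filter (fun x => ((T.erase x) ∩ U).card = i) := by
    rw [← filter_union, union_comm, sdiff_union_inter]
  have hdisj : Disjoint ((T ∩ U).filter (fun x => ((T.erase x) ∩ U).card = i))
      ((T \ U).filter (fun x => ((T.erase x) ∩ U).card = i)) :=
    disjoint_filter_filter (disjoint_sdiff_inter T U).symm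
  -- inside `U`: `(T.erase x) ∩ U = (T ∩ U).erase x`
  have hin : (T ∩ U).filter (fun x => ((T.erase x) ∩ U).card = i) =
      if (T ∩ U).card = i + 1 then T ∩ U else ∅ := by
    have key : ∀ x ∈ T ∩ U, ((T.erase x) ∩ U).card = (T ∩ U).card - 1 := by
      intro x hx
      rw [erase_inter, card_erase_of_mem hx]
    split_ifs with h
    · refine filter_true_of_mem fun x hx => ?_
      rw [key x hx, h]; rfl
    · refine filter_false_of_mem fun x hx => ?_
      rw [key x hx]
      have := card_pos.2 ⟨x, hx⟩
      omega
  -- outside `U`: `(T.erase x) ∩ U = T ∩ U`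
  have hout : (T \ U).filter (fun x => ((T.erase x) ∩ U).card = i) =
      if (T ∩ U).card = i then T \ U else ∅ := by
    have key : ∀ x ∈ T \ U, (T.erase x) ∩ U = T ∩ U := by
      intro x hx
      rw [erase_inter, erase_eq_of_notMem]
      exact fun h => (mem_sdiff.1 hx).2 (mem_inter.1 h).2
    split_ifs with h
    · exact filter_true_of_mem fun x hx => by rw [key x hx, h]
    · exact filter_false_of_mem fun x hx => by rw [key x hx]; exact h
  rw [hsplit, card_union_of_disjoint hdisj, hin, hout, Nat.cast_add]
  congr 1
  · split_ifs with h
    · rw [h]; push_cast; ring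
    · simp
  · split_ifs <;> simp

/-- **Zonal recurrence.** For `p` harmonic of degree `k` and any `U`:
`(i+1)·Σ_{|T ∩ U| = i+1} p_T + (k−i)·Σ_{|T ∩ U| = i} p_T = 0`. -/
theorem harmonic_zonal_step {k : ℕ} {p : Finset (Fin n) → ℝ} (hp : IsHarmonic k p)
    (U : Finset (Fin n)) (i : ℕ) :
    ((i : ℝ) + 1) * ∑ T ∈ univ.filter (fun T : Finset (Fin n) => (T ∩ U).card = i + 1), p T +
      ((k : ℝ) - i) * ∑ T ∈ univ.filter (fun T : Finset (Fin n) => (T ∩ U).card = i), p T = 0 := by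
  classical
  -- indicator of the class `|T' ∩ U| = i`
  set c : Finset (Fin n) → ℝ := fun T' => if (T' ∩ U).card = i then 1 else 0 with hc
  -- Step 1: harmonicity summed against `c`
  have h0 : ∑ T' : Finset (Fin n), c T' * down p T' = 0 := by
    rw [hp.2]; simp
  -- Step 2: expand `down` and swap the sums: `Σ_{T'} Σ_{x ∉ T'} c T' p (T' ∪ x) = Σ_T p T · #{x ∈ T : c (T \ x) = 1}`
  have hswap : ∑ T' : Finset (Fin n), c T' * down p T' =
      ∑ T : Finset (Fin n), p T * ∑ x ∈ T, c (T.erase x) := by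
    simp only [down_apply, mul_sum]
    have hL : ∑ T' : Finset (Fin n), ∑ x ∈ T'ᶜ, c T' * p (insert x T') =
        ∑ x : Fin n, ∑ T' ∈ univ.filter (fun T' : Finset (Fin n) => x ∉ T'), c T' * p (insert x T') := by
      rw [sum_comm' (t' := univ) (s' := fun x => univ.filter (fun T' : Finset (Fin n) => x ∉ T'))]
      intro x T'; simp
    have hR : ∑ T : Finset (Fin n), ∑ x ∈ T, p T * c (T.erase x) =
        ∑ x : Fin n, ∑ T ∈ univ.filter (fun T : Finset (Fin n) => x ∈ T), p T * c (T.erase x) := by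
      rw [sum_comm' (t' := univ) (s' := fun x => univ.filter (fun T : Finset (Fin n) => x ∈ T))]
      intro x T; simp
    rw [hL, hR]
    refine sum_congr rfl fun x _ => ?_
    rw [sum_filter_mem_eq_sum_filter_not_mem x (fun T => p T * c (T.erase x))]
    refine sum_congr rfl fun T' hT' => ?_
    simp only [mem_filter, mem_univ, true_and] at hT'
    rw [erase_insert hT', mul_comm]
  -- Step 3: the inner count
  have hcount : ∀ T : Finset (Fin n), ∑ x ∈ T, c (T.erase x) =
      (if (T ∩ U).card = i + 1 then ((i : ℝ) + 1) else 0) +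
        (if (T ∩ U).card = i then ((T \ U).card : ℝ) else 0) := by
    intro T
    rw [← card_filter_erase_inter_eq T U i, hc]
    simp only
    rw [← sum_filter, sum_const, nsmul_eq_mul, mul_one]
  rw [hswap] at h0
  simp only [hcount] at h0
  have hdist : ∑ T : Finset (Fin n), p T * ((if (T ∩ U).card = i + 1 then ((i : ℝ) + 1) else 0) +
      (if (T ∩ U).card = i then ((T \ U).card : ℝ) else 0)) =
      ∑ T ∈ univ.filter (fun T : Finset (Fin n) => (T ∩ U).card = i + 1), p T * ((i : ℝ) + 1) +
        ∑ T ∈ univ.filter (fun T : Finset (Fin n) => (T ∩ U).card = i), p T * ((T \ U).card : ℝ) := by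
    rw [sum_filter, sum_filter, ← sum_add_distrib]
    refine sum_congr rfl fun T _ => ?_
    split_ifs <;> ring
  rw [hdist] at h0
  -- Step 4: on the support of `p`, `|T \ U| = k − i` when `|T ∩ U| = i`
  have hsupp : ∑ T ∈ univ.filter (fun T : Finset (Fin n) => (T ∩ U).card = i), p T * ((T \ U).card : ℝ) =
      ((k : ℝ) - i) * ∑ T ∈ univ.filter (fun T : Finset (Fin n) => (T ∩ U).card = i), p T := by
    rw [mul_sum]
    refine sum_congr rfl fun T hT => ?_
    simp only [mem_filter, mem_univ, true_and] at hT
    by_cases hTk : T.card = k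
    · have h1 := card_sdiff_add_card_inter T U
      have h2 : ((T \ U).card : ℝ) = (k : ℝ) - i := by
        rw [← hTk, ← hT, ← h1]; push_cast; ring
      rw [h2, mul_comm]
    · rw [hp.1 T hTk]; ring
  rw [hsupp] at h0
  have hfirst : ∑ T ∈ univ.filter (fun T : Finset (Fin n) => (T ∩ U).card = i + 1), p T * ((i : ℝ) + 1) =
      ((i : ℝ) + 1) * ∑ T ∈ univ.filter (fun T : Finset (Fin n) => (T ∩ U).card = i + 1), p T := by
    rw [mul_sum]; exact sum_congr rfl fun T _ => mul_comm _ _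
  rw [hfirst] at h0
  linarith

/-- The top zonal sum of a homogeneous vector of degree `k` is its zeta transform:
`Σ_{|T ∩ U| = k} p_T = Σ_{T ⊆ U} p_T = zeta p (U)`. -/
theorem zonal_top_eq_zeta {k : ℕ} {p : Finset (Fin n) → ℝ} (hp : IsHomog k p) (U : Finset (Fin n)) :
    ∑ T ∈ univ.filter (fun T : Finset (Fin n) => (T ∩ U).card = k), p T = zeta p U := by
  classical
  rw [zeta_apply]
  -- both sides equal the sum over `T ⊆ U` with `|T| = k`
  have hL : ∑ T ∈ univ.filter (fun T : Finset (Fin n) => (T ∩ U).card = k), p T =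
      ∑ T ∈ (univ.filter (fun T : Finset (Fin n) => (T ∩ U).card = k)).filter (fun T => T.card = k), p T :=
    (sum_filter_of_ne fun T _ hpT => by by_contra h; exact hpT (hp T h)).symm
  have hR : ∑ T ∈ U.powerset, p T = ∑ T ∈ U.powerset.filter (fun T => T.card = k), p T :=
    (sum_filter_of_ne fun T _ hpT => by by_contra h; exact hpT (hp T h)).symm
  rw [hL, hR]
  refine sum_congr ?_ fun _ _ => rfl
  ext T
  simp only [mem_filter, mem_univ, true_and, mem_powerset]
  constructor
  · rintro ⟨h1, h2⟩
    refine ⟨?_, h2⟩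
    have : T ∩ U = T := eq_of_subset_of_card_le inter_subset_left (by rw [h1, h2])
    rw [← this]; exact inter_subset_right
  · rintro ⟨h1, h2⟩
    refine ⟨?_, h2⟩
    rw [inter_eq_left.2 h1, h2]

/-- Zonal sums above the degree vanish: `Σ_{|T ∩ U| = i} p_T = 0` for `i > k`. -/
theorem zonal_eq_zero_of_lt {k : ℕ} {p : Finset (Fin n) → ℝ} (hp : IsHomog k p) (U : Finset (Fin n))
    {i : ℕ} (hi : k < i) :
    ∑ T ∈ univ.filter (fun T : Finset (Fin n) => (T ∩ U).card = i), p T = 0 := by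
  refine sum_eq_zero fun T hT => hp T ?_
  simp only [mem_filter, mem_univ, true_and] at hT
  intro hTk
  have := card_le_card (inter_subset_left (s₁ := T) (s₂ := U))
  omega

/-- **The zonal identity.** For `p` harmonic of degree `k`, any `U` and `i ≤ k`:
`Σ_{|T ∩ U| = i} p_T = (−1)^{k−i} C(k,i) · zeta p (U)`. -/
theorem harmonic_zonal_eq_zeta {k : ℕ} {p : Finset (Fin n) → ℝ} (hp : IsHarmonic k p) (U : Finset (Fin n))
    {i : ℕ} (hi : i ≤ k) :
    ∑ T ∈ univ.filter (fun T : Finset (Fin n) => (T ∩ U).card = i), p T =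
      (-1 : ℝ) ^ (k - i) * (k.choose i : ℝ) * zeta p U := by
  -- descending induction on `i`, via `d = k - i`
  obtain ⟨d, hd⟩ : ∃ d, i + d = k := ⟨k - i, by omega⟩
  induction d generalizing i with
  | zero =>
    obtain rfl : i = k := by omega
    rw [Nat.sub_self, pow_zero, one_mul, Nat.choose_self, Nat.cast_one, one_mul]
    exact zonal_top_eq_zeta hp.1 U
  | succ d ih =>
    have hstep := harmonic_zonal_step hp U i
    rw [ih (by omega) (by omega)] at hstep
    have hk1 : k - (i + 1) = d := by omega
    have hk2 : k - i = d + 1 := by omega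
    rw [hk1] at hstep
    rw [hk2, pow_succ]
    have hd1 : (d : ℝ) + 1 ≠ 0 := by positivity
    have hsub : (k : ℝ) - i = (d : ℝ) + 1 := by
      rw [← hd]; push_cast; ring
    rw [hsub] at hstep
    -- binomial identity `(i+1)·C(k, i+1) = (k − i)·C(k, i)`
    have hbin : ((i : ℝ) + 1) * (k.choose (i + 1) : ℝ) = ((d : ℝ) + 1) * (k.choose i : ℝ) := by
      have h2 := Nat.choose_succ_right_eq k i
      rw [show k - i = d + 1 by omega] at h2
      have h2' : (k.choose (i + 1) : ℝ) * ((i : ℝ) + 1) = (k.choose i : ℝ) * ((d : ℝ) + 1) := by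
        exact_mod_cast h2
      linarith [h2']
    -- solve the linear relation `(i+1)·((-1)^d C(k,i+1) ζ) + (d+1)·Z_i = 0`
    have h3 : ((d : ℝ) + 1) * ∑ T ∈ univ.filter (fun T : Finset (Fin n) => (T ∩ U).card = i), p T =
        ((d : ℝ) + 1) * ((-1 : ℝ) ^ d * (-1) * (k.choose i : ℝ) * zeta p U) := by
      have : ((i : ℝ) + 1) * ((-1 : ℝ) ^ d * (k.choose (i + 1) : ℝ) * zeta p U) =
          (-1 : ℝ) ^ d * (((i : ℝ) + 1) * (k.choose (i + 1) : ℝ)) * zeta p U := by ring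
      rw [this, hbin] at hstep
      linarith
    exact mul_left_cancel₀ hd1 h3


/-! ### §2 Class-function kernels act as scalars on the harmonic layers -/

/-- The inner kernel sums `G_U(T) = Σ_{|V| = t, T ⊆ V} g(|U ∩ V|)` are invariant under simultaneous
relabelling: they depend only on `|U|`, `|T|`, `|U ∩ T|` (transitivity of `𝔖ₙ` on such pairs). -/
theorem innerSum_eq_of_card_eq (g : ℕ → ℝ) (t : ℕ) {U T U' T' : Finset (Fin n)}
    (hU : U.card = U'.card) (hT : T.card = T'.card) (hUT : (U ∩ T).card = (U' ∩ T').card) :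
    ∑ V ∈ (powersetCard t (univ : Finset (Fin n))).filter (fun V => T ⊆ V), g (U ∩ V).card =
      ∑ V ∈ (powersetCard t (univ : Finset (Fin n))).filter (fun V => T' ⊆ V), g (U' ∩ V).card := by
  classical
  obtain ⟨π, hπU, hπT⟩ := exists_perm_image_eq_pair U T U' T' hU hT hUT
  have hπU' : U.map π.toEmbedding = U' := by rw [map_eq_image]; exact hπU
  have hπT' : T.map π.toEmbedding = T' := by rw [map_eq_image]; exact hπT
  refine sum_equiv π.finsetCongr (fun V => ?_) (fun V hV => ?_)
  · simp only [mem_filter, mem_powersetCard, subset_univ, true_and, Equiv.finsetCongr_apply, card_map,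
      ← hπT', map_subset_map]
  · rw [Equiv.finsetCongr_apply, ← hπU', ← map_inter, card_map]

/-- **Class-function kernels act as scalars on the harmonic layers.** For every `g : ℕ → ℝ` and all
`t, k` there is a scalar `λ = λ(n,t,k,g)` such that for every harmonic `p` of degree `k` and every
`t`-set `U`: `Σ_{|V| = t} g(|U ∩ V|) · zeta p (V) = λ · zeta p (U)`. -/
theorem exists_classKernel_scalar (g : ℕ → ℝ) (t k : ℕ) :
    ∃ lam : ℝ, ∀ p : Finset (Fin n) → ℝ, IsHarmonic k p → ∀ U : Finset (Fin n), U.card = t →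
      ∑ V ∈ powersetCard t (univ : Finset (Fin n)), g (U ∩ V).card * zeta p V = lam * zeta p U := by
  classical
  -- the common value `γ i` of the inner sums on the class `|T| = k, |U ∩ T| = i` (0 if the class is empty)
  let γ : ℕ → ℝ := fun i =>
    if h : ∃ UT : Finset (Fin n) × Finset (Fin n), UT.1.card = t ∧ UT.2.card = k ∧ (UT.1 ∩ UT.2).card = i then
      ∑ V ∈ (powersetCard t (univ : Finset (Fin n))).filter (fun V => h.choose.2 ⊆ V), g (h.choose.1 ∩ V).card
    else 0
  refine ⟨∑ i ∈ range (k + 1), γ i * ((-1 : ℝ) ^ (k - i) * (k.choose i : ℝ)), fun p hp U hU => ?_⟩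
  -- expand `zeta` and swap: `Σ_V g(|U ∩ V|) Σ_{T ⊆ V} p_T = Σ_T p_T · G_U(T)`
  have hswap : ∑ V ∈ powersetCard t (univ : Finset (Fin n)), g (U ∩ V).card * zeta p V =
      ∑ T : Finset (Fin n), p T *
        ∑ V ∈ (powersetCard t (univ : Finset (Fin n))).filter (fun V => T ⊆ V), g (U ∩ V).card := by
    simp only [zeta_apply, mul_sum]
    rw [sum_comm' (t' := univ)
      (s' := fun T => (powersetCard t (univ : Finset (Fin n))).filter (fun V => T ⊆ V))
      (h := fun V T => by simp [mem_powerset])]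
    refine sum_congr rfl fun T _ => ?_
    exact sum_congr rfl fun V _ => mul_comm _ _
  rw [hswap]
  -- restrict to the support `|T| = k` and split by `i = |T ∩ U|`
  have hsupp : ∑ T : Finset (Fin n), p T *
        ∑ V ∈ (powersetCard t (univ : Finset (Fin n))).filter (fun V => T ⊆ V), g (U ∩ V).card =
      ∑ i ∈ range (k + 1), ∑ T ∈ univ.filter (fun T : Finset (Fin n) => (T ∩ U).card = i),
        p T * ∑ V ∈ (powersetCard t (univ : Finset (Fin n))).filter (fun V => T ⊆ V), g (U ∩ V).card := by
    rw [← sum_biUnion]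
    · symm
      apply sum_subset (subset_univ _)
      intro T _ hT
      have hTk : T.card ≠ k := by
        intro hTk
        apply hT
        rw [mem_biUnion]
        refine ⟨(T ∩ U).card, mem_range.2 ?_, by simp⟩
        have := card_le_card (inter_subset_left (s₁ := T) (s₂ := U))
        omega
      rw [hp.1 T hTk, zero_mul]
    · intro i _ j _ hij
      exact disjoint_filter.2 fun T _ h1 h2 => hij (h1.symm.trans h2)
  rw [hsupp, sum_mul]
  refine sum_congr rfl fun i hi => ?_
  have hik : i ≤ k := by have := mem_range.1 hi; omega
  -- on the class `|T ∩ U| = i` (and `|T| = k`), the inner sum is the constant `γ i`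
  have hconst : ∑ T ∈ univ.filter (fun T : Finset (Fin n) => (T ∩ U).card = i),
        p T * ∑ V ∈ (powersetCard t (univ : Finset (Fin n))).filter (fun V => T ⊆ V), g (U ∩ V).card =
      γ i * ∑ T ∈ univ.filter (fun T : Finset (Fin n) => (T ∩ U).card = i), p T := by
    rw [mul_sum]
    refine sum_congr rfl fun T hT => ?_
    simp only [mem_filter, mem_univ, true_and] at hT
    by_cases hTk : T.card = k
    · have hex : ∃ UT : Finset (Fin n) × Finset (Fin n),
          UT.1.card = t ∧ UT.2.card = k ∧ (UT.1 ∩ UT.2).card = i :=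
        ⟨(U, T), hU, hTk, by rw [inter_comm]; exact hT⟩
      have hγ : γ i = ∑ V ∈ (powersetCard t (univ : Finset (Fin n))).filter (fun V => T ⊆ V),
          g (U ∩ V).card := by
        simp only [γ, dif_pos hex]
        obtain ⟨h1, h2, h3⟩ := hex.choose_spec
        exact innerSum_eq_of_card_eq g t (h1.trans hU.symm) (h2.trans hTk.symm) (by rw [h3, inter_comm, hT])
      rw [hγ, mul_comm]
    · rw [hp.1 T hTk, zero_mul, mul_zero]
  rw [hconst, harmonic_zonal_eq_zeta hp U hik]
  ring

/-- **The scalar is read off any test pair.** If `p₀` is harmonic of degree `k` and `zeta p₀ (U₀) ≠ 0` for some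
`t`-set `U₀`, then for every harmonic `p` of degree `k` and every `t`-set `U`,
`Σ_{|V| = t} g(|U ∩ V|) zeta p (V) = (Σ_{|V| = t} g(|U₀ ∩ V|) zeta p₀ (V) / zeta p₀ (U₀)) · zeta p (U)`. -/
theorem classKernel_scalar_eq_of_test (g : ℕ → ℝ) {t k : ℕ} {p₀ : Finset (Fin n) → ℝ} (hp₀ : IsHarmonic k p₀)
    {U₀ : Finset (Fin n)} (hU₀ : U₀.card = t) (hne : zeta p₀ U₀ ≠ 0)
    {p : Finset (Fin n) → ℝ} (hp : IsHarmonic k p) {U : Finset (Fin n)} (hU : U.card = t) :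
    ∑ V ∈ powersetCard t (univ : Finset (Fin n)), g (U ∩ V).card * zeta p V =
      ((∑ V ∈ powersetCard t (univ : Finset (Fin n)), g (U₀ ∩ V).card * zeta p₀ V) / zeta p₀ U₀) *
        zeta p U := by
  obtain ⟨lam, hlam⟩ := exists_classKernel_scalar (n := n) g t k
  rw [hlam p hp U hU, hlam p₀ hp₀ U₀ hU₀, mul_div_cancel_right₀ _ hne]

end Summit.PneNP.PneNP.Theorems.ChebyshevTracialDesignHarmonicLayers
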